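import Literature.MathematicalPhysics.QuantumFieldTheory.Balaban1983to89.B9Eq376ProjPieceDirDictY
import Literature.MathematicalPhysics.QuantumFieldTheory.Balaban1983to89.B9Eq360PadDeltaCubeYAgree
import Literature.MathematicalPhysics.QuantumFieldTheory.Balaban1983to89.B9CubeDirInverseBondLocalityAtRecordY
import Literature.MathematicalPhysics.QuantumFieldTheory.Balaban1983to89.B9Cor35GDirGStep

/-!
# `Balaban1983to89.B9Eq376ProjWordDirCompressedCongr` — [Balaban1985BackgroundPropagators] (3.74)–(3.77) pp. 405–406 with p. 394 («They depend on the
# configuration U restricted to Ω₀») and p. 410 l. 14–15: THE DIRICHLET PROJECTION WORD `D_Ṽ𝒫_□(Ṽ)D*_Ṽ` OF THE CUBE SEQUENCE, COMPRESSED TO THE BONDS OVER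
# `Ω₀(□)`, READS `Ṽ` ONLY ON THE BONDS INSIDE `Ω₀(□)` — `𝟙♯·conj b((D_Ṽ𝒫_□(Ṽ)D*_Ṽ)♯)·𝟙♯ = 𝟙♯·conj b((D_{Ṽ′}𝒫_□(Ṽ′)D*_{Ṽ′})♯)·𝟙♯` for `Ṽ ≡ Ṽ′` on the bonds with
# both endpoints in `Ω₀(□)` — and the packaging of a whole-torus (3.84) split into the COMPRESSED split of FILE F2a (seat dag-n06-c g34, FILE F2b of road (B5)'s rest)

statement-level skeleton of published theorems with citation tags; proofs where landed; nothing here is a claim about the Yang–Mills mass gap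

CITATION HEADER (lean-in-tree rule).  B9 = T. Bałaban, *Propagators for lattice gauge theories in a background field*, Commun. Math. Phys. **99** (1985)
389–434 [Balaban1985BackgroundPropagators] (held `paper:balaban1985-cmp99-background-propagators`; journal page = PDF page + 388): (3.74)–(3.77) pp. 405–406
(the projection piece `D′R′D′* − DRD*` of the (3.84) remainder and its bound), (3.25)–(3.26) pp. 394–395 («Δ_a = Δ + DRD* + Q*aQ», `R = I − P`), p. 394 («Ω₀Δ′_aΩ₀ …
They depend on the configuration U restricted to Ω₀»), (3.3) p. 390 and (3.8) p. 392 (`D_U`, `D*_U`: the bond `⟨x, x + e_μ⟩` is transported by `U(x, x + e_μ)` to its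
end point), p. 409 l. 1–5 («G_□(U)»), p. 410 l. 14–15.  Rows B9.Eq3.76 × B9.Eq3.77 (cells only; no row head changes).

WHY THIS FILE (cell `pub-ymgap`, node N06 [B9]; dag-n06-d g35's LOCATED-35).  The letter of record is evaluated at a small field cut ONE LAYER BEYOND `Ω₀(□)`
(`cutCfgS i T η A`, `T ⊋ Ω₀(□)`: the Hessian's plaquettes through the bonds over `Ω₀` exit `Ω₀`), while this seat's (3.77) producer ✓`hPP_dirC_cube₀` sits at the
field cut AT `Ω₀(□)`.  The two fields agree on every bond with BOTH endpoints in `Ω₀(□)`; the uncompressed projection words `D_Ṽ𝒫_□(Ṽ)D*_Ṽ` differ (the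
outermost `D_Ṽ`, `D*_Ṽ` read the crossing bonds), but their compressions to `B = bondsOverY Ω₀(□)` COINCIDE: `𝒫_□(Ṽ)` lives on `Ω₀` and reads only the bonds inside
`Ω₀` (the Dirichlet letter `G′_□`, the knit legs of positive-level blocks, which sit inside `Ω₀`), `D*_Ṽ` transports a bond to its END point (so a bond over `Ω₀`
ending outside `Ω₀` is read by `D*` without `Ṽ`, and one ending inside is inside), and `D_Ṽ` evaluated at a bond over `Ω₀` transports the value at its end point,
which vanishes unless the end point is in `Ω₀`.  THIS FILE proves exactly this (§1–§2) and packages a whole-torus split `conj b((T(1) − T(Ṽ))♯) = W⁰ + Σ_νW¹_ν∇_ν +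
P_Ṽ + A` with `𝟙♯P_Ṽ𝟙♯ = 𝟙♯P′𝟙♯` into FILE F2a's compressed split with the piece `𝟙♯P′𝟙♯` (§3).

WHAT IS PROVED (0 `def`s; theorems; 0 sorry; 0 new named facts; standard axioms):
* §1 `UboxY_congr_of_inside` (bond agreement in torus coordinates), `divY_apply_congr_of_inside` (`(D*_ṼA)(z) = (D*_{Ṽ′}A)(z)` at `z ∈ S` for `A` supported on
  `bondsOverY S`), `gradY_apply_congr_of_inside` (`(D_Ṽψ)(b) = (D_{Ṽ′}ψ)(b)` at `b ∈ bondsOverY S` for `ψ` supported in `S`), `GpDirY_parKnitCubeY_congr_of_inside`,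
  `qpLegAgreeY_parKnitCubeY_of_inside`, ★`PDirCubeY_congr_of_inside` (`𝒫_□(Ṽ) = 𝒫_□(Ṽ′)`, operator level), `cubeProjY_comp_PDirCubeY`;
* §2 ★★`compr_gradPdiv_congr_of_inside` (`𝟙_B(D_Ṽ𝒫_□(Ṽ)D*_Ṽ)𝟙_B = 𝟙_B(D_{Ṽ′}𝒫_□(Ṽ′)D*_{Ṽ′})𝟙_B`), ★★`projK_projWordDir_projK_congr_of_inside` (realified, with the
  `U = 1` word subtracted: the `PP`-slot of the `G`-step);
* §3 ★`splitC_of_split_of_congr` (whole-torus split + compressed congruence of one piece ⇒ FILE F2a's `hsplitC`).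

HONEST SCOPE / NOT CLAIMED.  Locality bookkeeping (pointwise congruences of def-Y's transported lifts); no estimate.  Hypotheses: `S ⊇ {lev_□ ≥ 1}` (the cube
family's positive-level sites; true for `Ω₀(□)`: ✓`collarS2Y`) and the inside-bond agreement.  Nothing on `d = 4`, the continuum, reflection positivity or the
mass gap; NOT a node discharge; count-neutral; no row head changes.  NEW file; nothing landed is modified.  `--supports stmt-QuantumFields-27239`.

RELATED IN THE TREE, NOT DUPLICATED (searched 2026-08-31: `rg 'congr_of_inside|splitC_of_split'` over `Literature/` + `Summits/` = ∅): ✓`B9CubeDirInverseBondLocalityY`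
(`PCubeDY_congr`, `DPDsCubeDY_apply_congr` — the coarse pointwise congruence asking agreement at the bond read AND at the crossing bonds),
✓`B9CubeDirInverseBondCLocalityAtRecordY` (`PDirCubeY_congr_of_agree` from both-direction agreement at the sites of `S`), ✓`B9Eq360PadDeltaCubeYAgree`
(`GpDirY_congr_of_agree_inside` — the site letter's inside-bond locality, USED), ✓`B9Cor35GDirGStepCompressed` (F2a, the consumer).
-/

noncomputable section

namespace Literature.MathematicalPhysics.QuantumFieldTheory.Balaban1983to89.B9Eq376ProjWordDirCompressedCongr

open B9Eq352DivFormLetters (conj)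
open B6KLevelCensusIndexV1 (KIdx)
open B6Cover236MultiLevelBlocks (cubes)
open B6GlobalChartV1 (PV boxEquiv)
open B6Geom246MultiLevelBoxL0 (blkOf)
open B9CubeLettersOpsL0 (cubeFamY levCubeY)
open B9CubeLettersBondOpsL0 (BlkCubeY blkCornerCubeY)
open B9Eq360DeltaPrimeACubeY (blkCubeY cornerY_levCubeY_eq)
open B9Thm311CubeLettersFirstThree (levCubeY_eq_of_blkOf_eq)
open B9Eq359CubeKernelsKnitAtOne (avgTrCubeY_parKnitCubeY_congr_of_agree_block blkCubeY_eq_of_avgCoeffCubeY_ne_zero knitCubeY_congr_of_agree_block)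
open B9Eq360PadDeltaCubeYAgree (GpDirY_congr_of_agree_inside knitCubeY_of_levCubeY_eq_zero)
open B9CubeDirInverseBondLocalityY (QpLegAgreeY PCubeDY_congr PCubeDY_comp_cubeProjY)
open B9CubeDirInverseBondLocalityAtRecordY (parKnitCubeY_corner_congr_of_agree_block)
open B9Cor35GCubeInputsAtOne (DK)
open B9Cor35GDirGStep (projK projK_mul_projK)
open Node00 (SiteY FBondY CfgY toKT shiftY UboxY gradY divY gradT trLiftY gradK divK cornerY)
open Node00.OpsYNablaBridge (chartY shiftY_chartY)
open Node00.OpsYDeltaALocalAgree (trLiftY_apply_congr)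
open Node00.OpsYLocalInverse (cubeProjY cubeProjY_apply)
open Node00.OpsYCubeDirInverse (GpDirY cubeProjY_mul_GpDirY GpDirY_mul_cubeProjY)
open Node00.OpsYCubeKnitPar (parKnitCubeY parKnitCubeY_apply parOfTL_corner_left knitCubeY avgTrCubeY_parKnitCubeY)
open Node00.OpsYCubeProjectionG (insideBlkY PCubeDY PDirCubeY)
open Node00.OpsYCubeDirInverseBond (indProjY bondsOverY mem_bondsOverY compr_congr_of_apply)
open scoped Matrix

variable {d ℓ : ℕ} {hd : 1 ≤ d + 1} {hL : Odd (ℓ + 1) ∧ 1 < ℓ + 1} {b₀ b₁ : ℝ}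
variable {𝔸 : Type} [NormedRing 𝔸] [NormedAlgebra ℂ 𝔸] [CompleteSpace 𝔸]

/-! ## §1  Pointwise locality of `D*_Ṽ`, `D_Ṽ` on the bonds inside `S`, and `𝒫_□(Ṽ)` at the letters of record -/

section Pointwise

variable (i : KIdx d ℓ hd hL b₀ b₁) (q : ↥(cubes (toKT i).D.toDomains)) (S : Finset (SiteY i)) {V V' : CfgY 𝔸 i}
variable (hin : ∀ z ∈ S, ∀ μ : Fin (d + 1), shiftY i μ z ∈ S → UboxY i V μ z = UboxY i V' μ z)

include hin in
/-- the inside-bond agreement in torus coordinates: `V(b) = V′(b)` for a bond whose both endpoints chart into `S`. [cite: Balaban1985BackgroundPropagators, (3.1) p.390, p.394, dictionary] -/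
theorem UboxY_congr_of_inside (b : FBondY i) (hs : chartY i b.src ∈ S) (ht : chartY i b.tgt ∈ S) : V b.dir b.src = V' b.dir b.src := by
  have h := hin (chartY i b.src) hs b.dir (by rw [shiftY_chartY]; exact ht)
  change V b.dir ((boxEquiv i.hN).symm (boxEquiv i.hN b.src)) = V' b.dir ((boxEquiv i.hN).symm (boxEquiv i.hN b.src)) at h
  rwa [Equiv.symm_apply_apply] at h

include hin in
/-- ★ **`(D*_ṼA)(z) = (D*_{Ṽ′}A)(z)` AT `z ∈ S` FOR `A` SUPPORTED ON THE BONDS OVER `S`**: `D*` transports the bond `⟨x − e_μ, x⟩` to its END point `x` by `U(x − e_μ, x)`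
(✓`gradT`: the transporter is `U(b)` at `b₊` and `1` at `b₋`); such a bond with `A ≠ 0` starts in `S` and ends at `z ∈ S` — inside. [cite: Balaban1985BackgroundPropagators, (3.8) p.392, (3.3) p.390, p.394] -/
theorem divY_apply_congr_of_inside {A : FBondY i → 𝔸} (hA : ∀ b, b ∉ bondsOverY i S → A b = 0) {z : SiteY i} (hz : z ∈ S) :
    divY i V A z = divY i V' A z := by
  refine trLiftY_apply_congr fun b _ => ⟨rfl, fun hAb => ?_⟩
  have hsrc : chartY i b.src ∈ S := (mem_bondsOverY i).1 (by by_contra h; exact hAb (hA b h))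
  by_cases hzt : z = boxEquiv i.hN b.tgt
  · have ht : chartY i b.tgt ∈ S := by rw [chartY]; exact hzt ▸ hz
    simp only [gradT, if_pos hzt, UboxY_congr_of_inside i S hin b hsrc ht]
  · simp only [gradT, if_neg hzt]

include hin in
/-- ★ **`(D_Ṽψ)(b) = (D_{Ṽ′}ψ)(b)` AT A BOND OVER `S` FOR `ψ` SUPPORTED IN `S`**: `D` transports `ψ(b₊)` by `U(b)`; if `ψ(b₊) ≠ 0` then `b₊ ∈ S`, and `b₋ ∈ S` — inside.
[cite: Balaban1985BackgroundPropagators, (3.3) p.390, p.394] -/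
theorem gradY_apply_congr_of_inside {ψ : SiteY i → 𝔸} (hψ : ∀ z, z ∉ S → ψ z = 0) {b : FBondY i} (hb : b ∈ bondsOverY i S) :
    gradY i V ψ b = gradY i V' ψ b := by
  refine trLiftY_apply_congr fun z _ => ⟨rfl, fun hψz => ?_⟩
  have hzS : z ∈ S := by by_contra h; exact hψz (hψ z h)
  by_cases hzt : z = boxEquiv i.hN b.tgt
  · have ht : chartY i b.tgt ∈ S := by rw [chartY]; exact hzt ▸ hzS
    simp only [gradT, if_pos hzt, UboxY_congr_of_inside i S hin b ((mem_bondsOverY i).1 hb) ht]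
  · simp only [gradT, if_neg hzt]

variable (hS1 : ∀ z : SiteY i, 1 ≤ levCubeY i q z → z ∈ S)

include hin hS1 in
/-- ★ **`G′_□(Ṽ) = G′_□(Ṽ′)` AT THE KNIT LEGS FROM THE INSIDE-BOND AGREEMENT** (✓`GpDirY_congr_of_agree_inside`; the averaging transporters of a positive-level
block read the bonds inside that block `⊂ {lev_□ ≥ 1} ⊆ S`, those of a level-`0` pair are trivial). [cite: Balaban1985BackgroundPropagators, p.394 («depend on the configuration U restricted to Ω₀»), (3.19) p.393, (3.23)–(3.24) p.394] -/
theorem GpDirY_parKnitCubeY_congr_of_inside : GpDirY i q (parKnitCubeY i q) S V = GpDirY i q (parKnitCubeY i q) S V' := by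
  refine GpDirY_congr_of_agree_inside i q (parKnitCubeY i q) S (fun z hz μ hz' => hin z hz μ hz')
    (fun z hz μ hz' => hin _ hz' μ (by rw [Equiv.apply_symm_apply]; exact hz)) fun z _ w hzw _ => ?_
  rcases Nat.eq_zero_or_pos (levCubeY i q z) with h0 | hpos
  · have hb := blkCubeY_eq_of_avgCoeffCubeY_ne_zero i q hzw
    have hw0 : levCubeY i q w = 0 := (levCubeY_eq_of_blkOf_eq i q hb).trans h0
    rw [avgTrCubeY_parKnitCubeY i q _ hzw, avgTrCubeY_parKnitCubeY i q _ hzw, knitCubeY_of_levCubeY_eq_zero i q _ h0,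
      knitCubeY_of_levCubeY_eq_zero i q _ h0, knitCubeY_of_levCubeY_eq_zero i q _ hw0, knitCubeY_of_levCubeY_eq_zero i q _ hw0]
  · refine avgTrCubeY_parKnitCubeY_congr_of_agree_block i q hzw fun v μ hv hv' => ?_
    have hvS : v ∈ S := hS1 v (by rw [levCubeY_eq_of_blkOf_eq i q hv]; exact hpos)
    have hv'S : shiftY i μ v ∈ S := hS1 _ (by rw [levCubeY_eq_of_blkOf_eq i q hv']; exact hpos)
    exact hin v hvS μ hv'S

include hin hS1 in
/-- ★ **THE `Q′_□`-LEGS OF RECORD AGREE ON `S` FROM THE INSIDE-BOND AGREEMENT**: the corner leg to `z` is the knit leg `U(Γ^{(lev_□ z)})`, trivial at level `0`, and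
reading the bonds inside the (positive-level) block `⊂ S` otherwise. [cite: Balaban1985BackgroundPropagators, (3.19) p.393, (3.21) p.394, (3.24) p.395] -/
theorem qpLegAgreeY_parKnitCubeY_of_inside : QpLegAgreeY i q (parKnitCubeY i q) S V V' := by
  intro z hz s hs
  rcases Nat.eq_zero_or_pos (levCubeY i q z) with h0 | hpos
  · subst hs
    have hc : blkCornerCubeY i q (blkOf (cubeFamY i q).toDomains z) = cornerY i (levCubeY i q z) z := (cornerY_levCubeY_eq i q z).symm
    rw [hc, parKnitCubeY_apply, parKnitCubeY_apply, parOfTL_corner_left, parOfTL_corner_left]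
    change knitCubeY i q V z = knitCubeY i q V' z
    rw [knitCubeY_of_levCubeY_eq_zero i q _ h0, knitCubeY_of_levCubeY_eq_zero i q _ h0]
  · refine parKnitCubeY_corner_congr_of_agree_block i q hs fun v μ hv hv' => ?_
    have hvS : v ∈ S := hS1 v (by rw [levCubeY_eq_of_blkOf_eq i q (hv.trans hs.symm)]; exact hpos)
    have hv'S : shiftY i μ v ∈ S := hS1 _ (by rw [levCubeY_eq_of_blkOf_eq i q (hv'.trans hs.symm)]; exact hpos)
    exact hin v hvS μ hv'S

include hin hS1 in
/-- ★ **`𝒫_□(Ṽ) = 𝒫_□(Ṽ′)` AT THE LETTERS OF RECORD FROM THE INSIDE-BOND AGREEMENT** (operator level; ✓`PCubeDY_congr` fed by the two lemmas above).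
[cite: Balaban1985BackgroundPropagators, (3.25) p.394, p.409 l.1–5, p.410 l.14–15] -/
theorem PDirCubeY_congr_of_inside : PDirCubeY i q S V = PDirCubeY i q S V' :=
  PCubeDY_congr (insideBlkY i q S) (GpDirY_parKnitCubeY_congr_of_inside i q S hin hS1) (cubeProjY_mul_GpDirY i q _ S V') (GpDirY_mul_cubeProjY i q _ S V')
    (qpLegAgreeY_parKnitCubeY_of_inside i q S hin hS1)

/-- `Ω₀ ∘ 𝒫_□(Ṽ′) = 𝒫_□(Ṽ′)`: the projection of record takes values supported in `S` (`Ω₀G′_□ = G′_□`). [cite: Balaban1985BackgroundPropagators, (3.25) p.394, p.394 («Ω₀»), bookkeeping] -/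
theorem cubeProjY_comp_PDirCubeY (V' : CfgY 𝔸 i) : cubeProjY i S ∘ₗ PDirCubeY i q S V' = PDirCubeY i q S V' := by
  show cubeProjY i S ∘ₗ PCubeDY i q (parKnitCubeY i q) (GpDirY i q (parKnitCubeY i q) S) (insideBlkY i q S) V' = _
  unfold PCubeDY
  rw [← LinearMap.comp_assoc, ← Module.End.mul_eq_comp (cubeProjY i S) (GpDirY i q (parKnitCubeY i q) S V'), cubeProjY_mul_GpDirY]
  rfl

end Pointwise

/-! ## §2  The compressed projection word reads `Ṽ` only on the bonds inside `S` -/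

section Compressed

variable (i : KIdx d ℓ hd hL b₀ b₁) (q : ↥(cubes (toKT i).D.toDomains)) (S : Finset (SiteY i)) {V V' : CfgY 𝔸 i}
variable (hin : ∀ z ∈ S, ∀ μ : Fin (d + 1), shiftY i μ z ∈ S → UboxY i V μ z = UboxY i V' μ z)
variable (hS1 : ∀ z : SiteY i, 1 ≤ levCubeY i q z → z ∈ S)
include hin hS1

/-- ★★ **`𝟙_B(D_Ṽ𝒫_□(Ṽ)D*_Ṽ)𝟙_B = 𝟙_B(D_{Ṽ′}𝒫_□(Ṽ′)D*_{Ṽ′})𝟙_B`**, `B = bondsOverY S`: the compressed Dirichlet projection word reads `Ṽ` only on the bonds with both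
endpoints in `S`. [cite: Balaban1985BackgroundPropagators, (3.74)–(3.77) pp.405–406, (3.26) p.395, p.394 («They depend on the configuration U restricted to Ω₀»), p.410 l.14–15] -/
theorem compr_gradPdiv_congr_of_inside :
    indProjY (bondsOverY i S) * (gradY i V ∘ₗ PDirCubeY i q S V ∘ₗ divY i V) * indProjY (bondsOverY i S) =
      indProjY (bondsOverY i S) * (gradY i V' ∘ₗ PDirCubeY i q S V' ∘ₗ divY i V') * indProjY (bondsOverY i S) := by
  refine compr_congr_of_apply (bondsOverY i S) fun A hA b hb => ?_
  rw [PDirCubeY_congr_of_inside i q S hin hS1]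
  simp only [LinearMap.coe_comp, Function.comp_apply]
  -- `D*`: the two divergences agree on `S`, and `𝒫_□` reads its argument on `S` only
  have hdiv : cubeProjY i S (divY i V A) = cubeProjY i S (divY i V' A) := by
    refine funext fun z => ?_
    rw [cubeProjY_apply, cubeProjY_apply]
    split_ifs with hz
    · exact divY_apply_congr_of_inside i S hin hA hz
    · rfl
  have hP : PDirCubeY i q S V' ∘ₗ cubeProjY i S = PDirCubeY i q S V' :=
    PCubeDY_comp_cubeProjY (insideBlkY i q S) (GpDirY_mul_cubeProjY i q (parKnitCubeY i q) S V')
  have hmid : PDirCubeY i q S V' (divY i V A) = PDirCubeY i q S V' (divY i V' A) := by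
    rw [← hP]
    simp only [LinearMap.coe_comp, Function.comp_apply]
    rw [hdiv]
  rw [hmid]
  -- `D`: the value `𝒫_□(Ṽ′)(…)` is supported in `S`
  refine gradY_apply_congr_of_inside i S hin (fun z hz => ?_) hb
  have h := congrArg (fun T => T (divY i V' A) z) (cubeProjY_comp_PDirCubeY i q S V')
  simp only [LinearMap.coe_comp, Function.comp_apply, cubeProjY_apply, if_neg hz] at h
  exact h.symm

variable {ι : Type} [Fintype ι] (b : Module.Basis ι ℝ 𝔸)

/-- ★★ **THE `PP`-SLOT OF THE `G`-STEP, COMPRESSED, IS THE SAME AT `Ṽ` AND AT `Ṽ′`**: `𝟙♯·conj b((D_Ṽ𝒫_□(Ṽ)D*_Ṽ − D₁𝒫_□(1)D*₁)♯ℝ)·𝟙♯` agrees for two fields with the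
same bond variables inside `S` (realification of `compr_gradPdiv_congr_of_inside`). [cite: Balaban1985BackgroundPropagators, (3.76)–(3.77) pp.405–406, p.394, p.410 l.14–15] -/
theorem projK_projWordDir_projK_congr_of_inside :
    projK b i (bondsOverY i S) * conj b ((gradY i V ∘ₗ PDirCubeY i q S V ∘ₗ divY i V -
        gradY i (fun _ _ => 1) ∘ₗ PDirCubeY i q S (fun _ _ => 1) ∘ₗ divY i (fun _ _ => 1)).restrictScalars ℝ) * projK b i (bondsOverY i S) =
      projK b i (bondsOverY i S) * conj b ((gradY i V' ∘ₗ PDirCubeY i q S V' ∘ₗ divY i V' -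
        gradY i (fun _ _ => 1) ∘ₗ PDirCubeY i q S (fun _ _ => 1) ∘ₗ divY i (fun _ _ => 1)).restrictScalars ℝ) * projK b i (bondsOverY i S) := by
  have key : ∀ W : CfgY 𝔸 i, projK b i (bondsOverY i S) * conj b ((gradY i W ∘ₗ PDirCubeY i q S W ∘ₗ divY i W -
        gradY i (fun _ _ => 1) ∘ₗ PDirCubeY i q S (fun _ _ => 1) ∘ₗ divY i (fun _ _ => 1)).restrictScalars ℝ) * projK b i (bondsOverY i S) =
      conj b ((indProjY (bondsOverY i S) * (gradY i W ∘ₗ PDirCubeY i q S W ∘ₗ divY i W) * indProjY (bondsOverY i S) -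
        indProjY (bondsOverY i S) * (gradY i (fun _ _ => 1) ∘ₗ PDirCubeY i q S (fun _ _ => 1) ∘ₗ divY i (fun _ _ => 1)) *
          indProjY (bondsOverY i S)).restrictScalars ℝ) := fun W => by
    rw [projK, ← B9Eq352DivFormLetters.conj_mul, ← B9Eq352DivFormLetters.conj_mul]
    congr 1
    refine LinearMap.ext fun X => ?_
    simp only [Module.End.mul_apply, LinearMap.restrictScalars_apply, LinearMap.sub_apply, map_sub]
  rw [key, key, compr_gradPdiv_congr_of_inside i q S hin hS1]

end Compressed

/-! ## §3  Packaging a whole-torus split with one compressed-congruent piece into FILE F2a's compressed split -/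

section Packaging

variable {ι : Type} [Fintype ι] (b : Module.Basis ι ℝ 𝔸)
variable (i : KIdx d ℓ hd hL b₀ b₁) {B : Finset (FBondY i)}

omit [CompleteSpace 𝔸] in
/-- ★ **A WHOLE-TORUS (3.84) SPLIT WHOSE PROJECTION PIECE IS COMPRESSED-CONGRUENT TO ANOTHER IS A COMPRESSED SPLIT WITH THE OTHER PIECE COMPRESSED**: from
`X = W⁰ + Σ_νW¹_ν∇_ν + P + A` and `𝟙♯P𝟙♯ = 𝟙♯P′𝟙♯`, `𝟙♯X𝟙♯ = 𝟙♯(W⁰ + Σ_νW¹_ν∇_ν + 𝟙♯P′𝟙♯ + A)𝟙♯` (`𝟙♯𝟙♯ = 𝟙♯`).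
[cite: Balaban1985BackgroundPropagators, (3.82)–(3.84) p.407, p.394, bookkeeping] -/
theorem splitC_of_split_of_congr {X W0 PP PP' AV : Module.End ℝ (FBondY i × ι → ℝ)} {W1 : Fin (d + 1) → Module.End ℝ (FBondY i × ι → ℝ)}
    (hsplit : X = W0 + ∑ ν, W1 ν * DK b i ν + PP + AV) (hPP : projK b i B * PP * projK b i B = projK b i B * PP' * projK b i B) :
    projK b i B * X * projK b i B = projK b i B * (W0 + ∑ ν, W1 ν * DK b i ν + (projK b i B * PP' * projK b i B) + AV) * projK b i B := by
  have e1 : projK b i B * (projK b i B * PP' * projK b i B) * projK b i B = projK b i B * PP' * projK (𝔸 := 𝔸) b i B := by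
    rw [← mul_assoc, ← mul_assoc, projK_mul_projK, mul_assoc _ (projK b i B) (projK b i B), projK_mul_projK]
  rw [hsplit]
  simp only [mul_add, add_mul]
  rw [e1, hPP]

end Packaging

end Literature.MathematicalPhysics.QuantumFieldTheory.Balaban1983to89.B9Eq376ProjWordDirCompressedCongr

end
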